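import Summits.ValiantsHypothesis.ValiantsHypothesis.Theorems.BarrierLeverPartitionMinorsHitByVPJointPeelDefs

/-!
# Route BarrierLever — item `PartitionMinorsHitByVP` (stmt-ValiantsHypothesis-19717):
# JOINTLY PEELABLE pairs (row complex, column data) — the certificate format (one inductive predicate)

Helper file (`--supports stmt-ValiantsHypothesis-19717`; cell valiant-natproofs, rung V4, 𝒟-side door (c); prover
seat val-np-p6 gen 6). ONE INDUCTIVE PREDICATE; the theorems «`JointlyPeelable` ⇒ Moore determinant ≠ 0 ⇒ layout hit»
are in the definition-free companion `…HitByVPJointPeelHit`.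

`JointlyPeelable p k d n R W` — a CERTIFICATE that the pair (rows `R` = a set family over `Fin n`, columns `T ↦ W T ⊆
Fin k`) can be peeled down to families with at most one member by the JOINT PEEL of `…HitByVPJointPeel`:
* `small` — `R.card ≤ 1`;
* `peel` — `R` down-closed, a digit `c₀` strictly below every other digit used, bijections
  `κ₀ : Fam (famDel R) ≃ {T // c₀ ∉ W T}`, `κ₁ : Fam (famLink R) ≃ {T // c₀ ∈ W T}` («no tie»), and certificates for the
  two pieces (deletion × high columns, link × tails);
* `relabel` — a certificate for the row family relabelled by a node permutation `π` (so that any node can be peeled).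
Seat census (memo RESIDUE-v8 §1): jointly peelable pairs are ≈ 62 % of the labelled lower-set pairs at `h = 4` (exactly the
pairs of isomorphic complexes there) and ≈ 47 % of random lower-set pairs at `h = 5` (including non-isomorphic ones with
equal recursive link/deletion counts); ball × ball and Δ × Δ (`…MooreBallBall`, `…SamePattern`) are the closed-form instances.

WHAT THIS IS NOT: a certificate FORMAT (no claim which pairs admit one); nothing on crux 14610 or VP vs VNP.
-/

set_option linter.dupNamespace false

namespace Summit.ValiantsHypothesis.ValiantsHypothesis.Theorems.BarrierLever.FrobeniusDoor

open Finset MvPolynomial Matrix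

/-- **Jointly peelable pair** (certificate for the joint peel; see the module docstring). The prime `p` enters only
through the matrices the certificate is about (`colMatrix p …`); the predicate itself is combinatorial. -/
inductive JointlyPeelable (k : ℕ) (d : Fin k → ℕ) :
    (n : ℕ) → (R : Finset (Finset (Fin n))) → (Fam R → Finset (Fin k)) → Prop
  | small {n : ℕ} {R : Finset (Finset (Fin n))} {W : Fam R → Finset (Fin k)} (hR : R.card ≤ 1) :
      JointlyPeelable k d n R W
  | peel {n : ℕ} {R : Finset (Finset (Fin (n + 1)))} {W : Fam R → Finset (Fin k)} (hR : IsDownClosedFam R)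
      (c₀ : Fin k) (hmin : ∀ T, ∀ x ∈ W T, x ≠ c₀ → d c₀ < d x)
      (κ₀ : Fam (famDel R) ≃ {T : Fam R // c₀ ∉ W T}) (κ₁ : Fam (famLink R) ≃ {T : Fam R // c₀ ∈ W T})
      (hdel : JointlyPeelable k d n (famDel R) (fun S => W (κ₀ S).1))
      (hlink : JointlyPeelable k d n (famLink R) (fun S => (W (κ₁ S).1).erase c₀)) :
      JointlyPeelable k d (n + 1) R W
  | relabel {n : ℕ} {R : Finset (Finset (Fin n))} {W : Fam R → Finset (Fin k)} (π : Equiv.Perm (Fin n))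
      (e : Fam R ≃ Fam (R.map (Finset.mapEmbedding π.toEmbedding).toEmbedding))
      (he : ∀ S : Fam R, (e S).1 = S.1.map π.toEmbedding)
      (h : JointlyPeelable k d n (R.map (Finset.mapEmbedding π.toEmbedding).toEmbedding) (fun T => W (e.symm T))) :
      JointlyPeelable k d n R W

end Summit.ValiantsHypothesis.ValiantsHypothesis.Theorems.BarrierLever.FrobeniusDoor
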